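import Mathlib
import Literature.NumberTheory.Transcendental.KZCalculus
import Literature.NumberTheory.Transcendental.KZBallPeelingAux

/-!
# The arctangent tail `[(0,∞), 4/(1+x²)] ~ [ℝ, 2/(1+x²)]` (stub `stub_arctanTail`, line `Sketch`
# (hat-box chart), crux `UnfoldedStokes.LegendreCubicForm`, stmt-KontsevichZagierPeriods-3521)

The genus-`0` tail of the hat-box line for Legendre's relation on `y² = (x−e₁)(x−e₂)(x−e₃)`:
any representation `q = [(0,∞), 4/(1+x²)]` (value `2π`) is equivalent, in the Kontsevich–Zagier
calculus of moves, to any representation `r' = [ℝ, 2/(1+x²)]` (value `2π`). Four bookkeeping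
moves, all with rational data:

* rule (1a) with the null point `{0}`: `[ℝ, f] − [ℝ ∖ {0}, f] ∈ relations`
  (`KZ.IntegralRep.of_sub_of_restrict_mem_relations`);
* rule (1a): `[ℝ ∖ {0}, f] − [(−∞,0), f] − [(0,∞), f] ∈ domainAddRel`;
* rule (2), the reflection `x ↦ −x` (`KZ.BallPeeling.of_sub_of_mem_relations_of_neg`):
  `[(−∞,0), f] − [(0,∞), f] ∈ relations`, `f = 2/(1+x²)` being even;
* rule (1b): `[(0,∞), 4/(1+x²)] − [(0,∞), f] − [(0,∞), f] ∈ integrandAddRel`.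

References: M. Kontsevich, D. Zagier, *Periods* (2001), §1.1 (`π = ∫ dx/(1+x²)`), §1.2 rules (1), (2).
-/

noncomputable section

namespace Summit.KontsevichZagierPeriods.UnfoldedStokes.LegendreCubicFormLine

open Set MeasureTheory
open Literature.NumberTheory.Transcendental
open Literature.ModelTheory.ExponentialFields (IsSemialgebraic)
open MvPolynomial (aeval X)

/-- The ray `(0, ∞) ⊆ ℝ¹` is `ℚ`-semialgebraic (positivity set of the coordinate polynomial).
[folklore] -/
private theorem isSemialgebraic_setOf_apply_zero_pos : IsSemialgebraic ℚ {x : Fin 1 → ℝ | 0 < x 0} := by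
  have e : {x : Fin 1 → ℝ | 0 < x 0} = {x | 0 < aeval x (X 0 : MvPolynomial (Fin 1) ℚ)} := by
    ext x
    simp
  rw [e]
  exact Literature.ModelTheory.ExponentialFields.isSemialgebraic_setOf_eval_pos _

/-- The ray `(−∞, 0) ⊆ ℝ¹` is `ℚ`-semialgebraic (positivity set of minus the coordinate polynomial).
[folklore] -/
private theorem isSemialgebraic_setOf_apply_zero_neg : IsSemialgebraic ℚ {x : Fin 1 → ℝ | x 0 < 0} := by
  have e : {x : Fin 1 → ℝ | x 0 < 0} = {x | 0 < aeval x (-X 0 : MvPolynomial (Fin 1) ℚ)} := by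
    ext x
    simp
  rw [e]
  exact Literature.ModelTheory.ExponentialFields.isSemialgebraic_setOf_eval_pos _

/-- ARCTANGENT TAIL: `[(0,∞), 4/(1+x²)] ~ [ℝ, 2/(1+x²)]` — integrand additivity `4 = 2 + 2`, the reflection `x ↦ −x`
of one copy onto `(−∞,0)` (rule 2), and domain additivity `ℝ = (−∞,0) ∪ {0} ∪ (0,∞)` with the null point (rule 1).
[cite: KontsevichZagier2001, §1.2] -/
theorem stub_arctanTail :
    ∀ (q r' : KZ.IntegralRep 1), q.domain = {x : Fin 1 → ℝ | 0 < x 0} →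
      Set.EqOn q.integrand (fun x : Fin 1 → ℝ => 4 / (1 + x 0 ^ 2)) q.domain →
      r'.domain = Set.univ → Set.EqOn r'.integrand (fun x => 2 / (1 + x 0 ^ 2)) r'.domain →
      KZ.Equivalent q r' := by
  intro q r' hqd hqi hr'd hr'i
  -- the integrand of `r'` is `2/(1+x²)` everywhere
  have hr'i' : ∀ x, r'.integrand x = 2 / (1 + x 0 ^ 2) := fun x =>
    hr'i (by rw [hr'd]; exact mem_univ x)
  have hPsub : {x : Fin 1 → ℝ | 0 < x 0} ⊆ r'.domain := by rw [hr'd]; exact subset_univ _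
  have hNsub : {x : Fin 1 → ℝ | x 0 < 0} ⊆ r'.domain := by rw [hr'd]; exact subset_univ _
  have hUsa : IsSemialgebraic ℚ ({x : Fin 1 → ℝ | x 0 < 0} ∪ {x : Fin 1 → ℝ | 0 < x 0}) :=
    isSemialgebraic_setOf_apply_zero_neg.union isSemialgebraic_setOf_apply_zero_pos
  have hUsub : {x : Fin 1 → ℝ | x 0 < 0} ∪ {x : Fin 1 → ℝ | 0 < x 0} ⊆ r'.domain :=
    union_subset hNsub hPsub
  -- the two halves `A = [(−∞,0), f]`, `B = [(0,∞), f]` of `r'`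
  obtain ⟨A, hAd, hAi⟩ : ∃ s : KZ.IntegralRep 1, s.domain = {x : Fin 1 → ℝ | x 0 < 0} ∧
      s.integrand = r'.integrand :=
    ⟨r'.restrict _ isSemialgebraic_setOf_apply_zero_neg hNsub, rfl, rfl⟩
  obtain ⟨B, hBd, hBi⟩ : ∃ s : KZ.IntegralRep 1, s.domain = {x : Fin 1 → ℝ | 0 < x 0} ∧
      s.integrand = r'.integrand :=
    ⟨r'.restrict _ isSemialgebraic_setOf_apply_zero_pos hPsub, rfl, rfl⟩
  -- (1) remove the null point `x = 0` (rule 1a with a null piece)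
  have e1 : KZ.of r' - KZ.of (r'.restrict _ hUsa hUsub) ∈ KZ.relations := by
    refine r'.of_sub_of_restrict_mem_relations hUsa hUsub
      (measure_mono_null (fun x hx => ?_) (KZ.BallPeeling.volume_setOf_apply_eq_const 1 0 0))
    have h3 := hx.2
    simp only [mem_union, mem_setOf_eq, not_or, not_lt] at h3
    show x 0 = 0
    exact le_antisymm h3.2 h3.1
  -- (2) domain additivity `ℝ ∖ {0} = (−∞,0) ∪ (0,∞)` (rule 1a)
  have e2 : KZ.of (r'.restrict _ hUsa hUsub) - KZ.of A - KZ.of B ∈ KZ.relations := by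
    refine KZ.domainAddRel_subset_relations ⟨1, _, A, B, by rw [hAd, hBd]; rfl, ?_,
      fun x _ => by rw [hAi]; rfl, fun x _ => by rw [hBi]; rfl, rfl⟩
    rw [hAd, hBd]
    refine measure_mono_null (fun x hx => ?_) measure_empty
    simp only [mem_inter_iff, mem_setOf_eq] at hx
    exact (lt_irrefl (0 : ℝ) (hx.2.trans hx.1)).elim
  -- (3) the reflection `x ↦ −x` folds `(−∞,0)` onto `(0,∞)` (rule 2; the integrand is even)
  have e3 : KZ.of A - KZ.of B ∈ KZ.relations := by
    refine KZ.BallPeeling.of_sub_of_mem_relations_of_neg ?_ fun x _ => ?_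
    · rw [hAd, hBd]
      ext y
      simp only [mem_setOf_eq, mem_image]
      constructor
      · intro hy
        exact ⟨-y, by simp only [Pi.neg_apply]; linarith, neg_neg y⟩
      · rintro ⟨x, hx, rfl⟩
        simp only [Pi.neg_apply]
        linarith
    · rw [hAi, hBi, hr'i', hr'i']
      simp only [Pi.neg_apply, neg_sq]
  -- (4) integrand additivity `4/(1+x²) = 2/(1+x²) + 2/(1+x²)` on `(0,∞)` (rule 1b)
  have e4 : KZ.of q - KZ.of B - KZ.of B ∈ KZ.relations := by
    refine KZ.integrandAddRel_subset_relations ⟨1, q, B, B, by rw [hqd, hBd], by rw [hqd, hBd],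
      fun x hx => ?_, rfl⟩
    rw [hqi hx, Pi.add_apply, hBi, hr'i']
    ring
  -- add up in the subgroup of relations
  have : KZ.of q - KZ.of r' = (KZ.of q - KZ.of B - KZ.of B) -
      (KZ.of (r'.restrict _ hUsa hUsub) - KZ.of A - KZ.of B) -
      (KZ.of r' - KZ.of (r'.restrict _ hUsa hUsub)) - (KZ.of A - KZ.of B) := by abel
  show KZ.of q - KZ.of r' ∈ KZ.relations
  rw [this]
  exact KZ.relations.sub_mem (KZ.relations.sub_mem (KZ.relations.sub_mem e4 e2) e1) e3

end Summit.KontsevichZagierPeriods.UnfoldedStokes.LegendreCubicFormLine
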